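import Mathlib

/-!
# T4TriangularPushforward — product measures under maps with private coordinates (pub-balaban, row T4-D.G-AC3)

Module M3a of the plan `HOME/t4/T4-EST-HaarAC.md` (owner `b2b-balaban-pv26` lineage) toward the absolute-continuity input
`HaarAC (BlockAveraging.avgFun su2Mean)` of `T4FiniteEpsInhabited` (B12 = [Balaban1987RG1] (0.3)–(0.4) p. 253: Bałaban's
block averaging `U ↦ Ū` should map the product Haar measure `dU = ∏_b dU(b)` of B7 = [Balaban1985Averaging] (10) p. 19,
tree `Setup.fieldMeasure`, to a measure absolutely continuous with respect to product Haar measure on the coarse bonds —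
cell GAPS G-pv26g2-1, the unstated existence of `Tρ` as a function).  PURPOSE ONLY — no journal text is typed or quoted
here; the module is abstract measure theory over Mathlib, every declaration [folklore].  Row T4-D.G-AC3 of `t4/T4-DAG.md`
v3 §5; the file merges the parallel drafts of the pv26 (§§1–3) and pv03 (§4) lineages under one claim.

SETTING.  Finite index types `ι` (fine bonds) and `κ` (coarse bonds), a measurable space `G` with a measure `μ` (one-bond
Haar measure), a measurable map `A : (ι → G) → (κ → G)` (block averaging) and an injection `β : κ → ι` assigning to every
output coordinate `c` a PRIVATE input coordinate `β c` (in the application: the central crossing bond of `c`, memo §1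
Fact A):
* `IsLocal β A` (§2): changing the input at `β c` does not change any output coordinate `c' ≠ c`;
* ONE-VARIABLE LAWS: for every (§3) — or for `μ^ι`-almost every (§4) — configuration `U` and every `c`, the law
  `μ.map (g ↦ A (update U (β c) g) c)` is absolutely continuous with respect to `μ`.

THEOREM `map_pi_absolutelyContinuous_pi` (§3; `μ` σ-finite, one-variable laws a.c. for EVERY `U`): then
`(Measure.pi (fun _ : ι ↦ μ)).map A ≪ Measure.pi (fun _ : κ ↦ μ)`.
PROOF (null sets only — no densities, no Radon–Nikodym): write a `pi`-null set `N` as the vanishing of the full marginal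
of `1_N`; peel the output coordinates one at a time (`MeasureTheory.lmarginal_insert`): at coordinate `c` the inner marginal
vanishes for `μ`-a.e. value, hence (absolute continuity of the one-variable law, `ae_of_ae_map`) for `μ`-a.e. value of the
private input `β c`, and locality identifies `A (update U (β c) g)` with `update (A U) c _` (`apply_update_eq`); induction
over `Finset κ` (`lmarginal_image_eq_zero`), then integrate out the non-private inputs (`lmarginal_union`).

THEOREM `map_pi_absolutelyContinuous_pi_ae` (§4; `μ` a probability measure, one-variable laws a.c. for `μ^ι`-A.E. `U` —
the wording of row T4-D.G-AC3 "for a.e. environment"): same conclusion.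
PROOF (resampling): `res (U, g) := Function.extend β g U` (replace every private coordinate by a fresh independent copy)
is MEASURE PRESERVING `μ^ι ⊗ μ^κ → μ^ι` (`measurePreserving_resample`, box computation with `Measure.pi_eq`), and by
locality `A (res (U, g)) c = A (update U (β c) (g c)) c` (`apply_resample_eq`); so `(μ^ι).map A` is the law of
`(U, g) ↦ (c ↦ A (update U (β c) (g c)) c)` under `μ^ι ⊗ μ^κ`, which conditionally on the environment `U` is a product of
independent absolutely continuous coordinates (`Measure.pi_map_pi` and `pi_absolutelyContinuous_pi`: finite products of
a.c. measures are a.c.), and a mixture of a.c. measures is a.c. (`map_prod_pi_absolutelyContinuous`, `Measure.prod_apply`).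

Also (§1): `absolutelyContinuous_map_of_forall_eq_or` (a map taking at every point one of two values whose laws are a.c.
has an a.c. law — the `Small`/large-field case split of (0.4)) and `absolutelyContinuous_map_of_map_eq`.

Consumer: row T4-D.G-AC4 (module M3b of the memo) instantiates `ι := PBond P j`, `κ := PBond P (j+1)`, `G := SU(2)`,
`μ :=` Haar probability, `A := BlockAveraging.avgFun su2Mean`, `β :=` the central crossing bond, with `IsLocal` from the
memo's Fact A and the one-variable laws from rows AC1/AC2 (`T4RadialProjectionAC`, `T4HaarSU2Translate`).
VALUE = kernel measure theory; NOT an estimate of the papers, NOT summit progress.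
-/

noncomputable section

open MeasureTheory Set Function
open scoped ENNReal

namespace Literature.MathematicalPhysics.QuantumFieldTheory.Balaban1983to89.T4TriangularPushforward

/-! ## 1. Two elementary closure properties of absolute continuity of laws -/

section Elementary

variable {α γ : Type*} [MeasurableSpace α] [MeasurableSpace γ] {μ : Measure α} {ν : Measure γ}

/-- If `f` takes at every point the value of `f₁` or of `f₂`, and the laws of `f₁`, `f₂` are absolutely continuous with
respect to `ν`, so is the law of `f`. [folklore] -/
theorem absolutelyContinuous_map_of_forall_eq_or {f f₁ f₂ : α → γ} (hf : Measurable f) (hf₁ : Measurable f₁)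
    (hf₂ : Measurable f₂) (h : ∀ x, f x = f₁ x ∨ f x = f₂ x) (h₁ : μ.map f₁ ≪ ν) (h₂ : μ.map f₂ ≪ ν) :
    μ.map f ≪ ν := by
  refine Measure.AbsolutelyContinuous.mk fun N hN hνN => ?_
  rw [Measure.map_apply hf hN]
  have h₁' : μ (f₁ ⁻¹' N) = 0 := by rw [← Measure.map_apply hf₁ hN]; exact h₁ hνN
  have h₂' : μ (f₂ ⁻¹' N) = 0 := by rw [← Measure.map_apply hf₂ hN]; exact h₂ hνN
  refine measure_mono_null (fun x hx => ?_) (measure_union_null h₁' h₂')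
  rcases h x with hx' | hx'
  · exact Or.inl (show f₁ x ∈ N by rw [← hx']; exact hx)
  · exact Or.inr (show f₂ x ∈ N by rw [← hx']; exact hx)

/-- A measure-preserving self-map has an absolutely continuous law. [folklore] -/
theorem absolutelyContinuous_map_of_map_eq {f : α → α} (h : μ.map f = μ) : μ.map f ≪ μ := by
  rw [h]

/-- Finite products of absolutely continuous σ-finite measures are absolutely continuous, `Fin n`-indexed case:
`(∀ i, ν i ≪ μ i) → Measure.pi ν ≪ Measure.pi μ` (induction on `n` along `MeasurableEquiv.piFinSuccAbove`, using
`Measure.AbsolutelyContinuous.prod`). [folklore] -/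
theorem pi_absolutelyContinuous_pi_fin {n : ℕ} {μ ν : Fin n → Measure γ} [∀ i, SigmaFinite (μ i)]
    [∀ i, SigmaFinite (ν i)] (h : ∀ i, ν i ≪ μ i) : Measure.pi ν ≪ Measure.pi μ := by
  induction n with
  | zero =>
      rw [Measure.pi_of_empty μ, Measure.pi_of_empty ν]
  | succ n ih =>
      have hμ := measurePreserving_piFinSuccAbove μ 0
      have hν := measurePreserving_piFinSuccAbove ν 0
      have ih' : Measure.pi (fun j => ν (Fin.succAbove 0 j)) ≪ Measure.pi (fun j => μ (Fin.succAbove 0 j)) :=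
        ih (fun j => h _)
      have hprod : (ν 0).prod (Measure.pi fun j => ν (Fin.succAbove 0 j)) ≪
          (μ 0).prod (Measure.pi fun j => μ (Fin.succAbove 0 j)) := (h 0).prod ih'
      have := hprod.map (MeasurableEquiv.piFinSuccAbove (fun _ : Fin (n+1) => γ) 0).symm.measurable
      rwa [(hν.symm _).map_eq, (hμ.symm _).map_eq] at this

/-- Finite products of absolutely continuous σ-finite measures are absolutely continuous:
`(∀ i, ν i ≪ μ i) → Measure.pi ν ≪ Measure.pi μ` (transport of the `Fin n` case along `MeasurableEquiv.piCongrLeft`).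
[folklore] -/
theorem pi_absolutelyContinuous_pi {ι : Type*} [Fintype ι] {μ ν : ι → Measure γ} [∀ i, SigmaFinite (μ i)]
    [∀ i, SigmaFinite (ν i)] (h : ∀ i, ν i ≪ μ i) : Measure.pi ν ≪ Measure.pi μ := by
  set e := (Fintype.equivFin ι).symm with he
  have hμ := measurePreserving_piCongrLeft μ e
  have hν := measurePreserving_piCongrLeft ν e
  have hfin : Measure.pi (fun i' => ν (e i')) ≪ Measure.pi (fun i' => μ (e i')) :=
    pi_absolutelyContinuous_pi_fin (fun i' => h _)
  have := hfin.map (MeasurableEquiv.piCongrLeft (fun _ : ι => γ) e).measurable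
  rwa [hν.map_eq, hμ.map_eq] at this

end Elementary

/-! ## 2. Locality and the triangular structure -/

section Triangular

variable {ι κ G : Type*} [DecidableEq ι] [DecidableEq κ] [MeasurableSpace G]

/-- `IsLocal β A`: the output coordinate `c'` of `A` does not see the private input coordinate `β c` of any other output
coordinate `c ≠ c'`. [folklore] -/
def IsLocal (β : κ → ι) (A : (ι → G) → (κ → G)) : Prop :=
  ∀ (U : ι → G) (c : κ) (g : G) (c' : κ), c' ≠ c → A (update U (β c) g) c' = A U c'

variable {β : κ → ι} {A : (ι → G) → (κ → G)}

omit [MeasurableSpace G] in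
/-- Under locality, updating the private input of `c` updates only the output coordinate `c`. [folklore] -/
theorem apply_update_eq (hA : IsLocal β A) (U : ι → G) (c : κ) (g : G) :
    A (update U (β c) g) = update (A U) c (A (update U (β c) g) c) := by
  funext c'
  by_cases h : c' = c
  · subst h
    rw [update_self]
  · rw [update_of_ne h]
    exact hA U c g c' h

omit [DecidableEq κ] [MeasurableSpace G] in
/-- AGREEMENT OFF THE OTHER PRIVATE COORDINATES.  Under locality, if two configurations `V W` differ only at private
coordinates `β c'` of output coordinates `c' ≠ c` (all lying in a finite set `T`), then `A V c = A W c` (induction on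
`T`, one update at a time). [folklore] -/
theorem apply_eq_of_agree (hA : IsLocal β A) (c : κ) (T : Finset ι) :
    ∀ (V W : ι → G), (∀ i, V i ≠ W i → i ∈ T) → (∀ i ∈ T, ∃ c', c' ≠ c ∧ β c' = i) → A V c = A W c := by
  induction T using Finset.induction_on with
  | empty =>
      intro V W hVW _
      have : V = W := funext fun i => by
        by_contra hne
        simpa using hVW i hne
      rw [this]
  | @insert i T hi ih =>
      intro V W hVW hT
      obtain ⟨c', hc', rfl⟩ := hT _ (Finset.mem_insert_self _ _)
      have h1 : A V c = A (update W (β c') (V (β c'))) c := by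
        refine ih V _ (fun j hj => ?_) (fun j hj => hT j (Finset.mem_insert_of_mem hj))
        have hji : j ≠ β c' := by
          rintro rfl
          exact hj (by simp)
        have hne : V j ≠ W j := by simpa [update_of_ne hji] using hj
        exact (Finset.mem_insert.mp (hVW j hne)).resolve_left hji
      rw [h1, hA W c' (V (β c')) c hc'.symm]

omit [DecidableEq κ] [MeasurableSpace G] in
/-- RESAMPLED CONFIGURATION SEEN BY ONE OUTPUT.  With `res (U, g) := Function.extend β g U` (every private coordinate
`β c'` replaced by `g c'`, all other coordinates kept), locality gives `A (res (U, g)) c = A (update U (β c) (g c)) c`.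
[folklore] -/
theorem apply_resample_eq [Fintype κ] (hA : IsLocal β A) (hβ : Injective β) (U : ι → G) (g : κ → G) (c : κ) :
    A (extend β g U) c = A (update U (β c) (g c)) c := by
  classical
  refine apply_eq_of_agree hA c ((Finset.univ.erase c).image β) _ _ (fun i hi => ?_) (fun i hi => ?_)
  · by_cases h : ∃ c', β c' = i
    · obtain ⟨c', rfl⟩ := h
      have hc' : c' ≠ c := by
        rintro rfl
        exact hi (by simp [hβ.extend_apply])
      exact Finset.mem_image.mpr ⟨c', Finset.mem_erase.mpr ⟨hc', Finset.mem_univ _⟩, rfl⟩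
    · exfalso
      apply hi
      have hne : i ≠ β c := fun h' => h ⟨c, h'.symm⟩
      rw [extend_apply' _ _ _ h, update_of_ne hne]
  · obtain ⟨c', hc', rfl⟩ := Finset.mem_image.mp hi
    exact ⟨c', (Finset.mem_erase.mp hc').1, rfl⟩

variable (μ : Measure G) [SigmaFinite μ]

/-! ## 3. The peeling proof: one-variable laws a.c. for every configuration, `μ` σ-finite -/

/-- THE PEELING INDUCTION. If the marginal of `f` over the output coordinates `s` vanishes at `A U`, then the marginal of
`f ∘ A` over the private inputs `β '' s` vanishes at `U` — for every `U`. [folklore] -/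
theorem lmarginal_image_eq_zero (hA : IsLocal β A) (hβ : Injective β) (hAm : Measurable A)
    (hac : ∀ (U : ι → G) (c : κ), μ.map (fun g => A (update U (β c) g) c) ≪ μ)
    {f : (κ → G) → ℝ≥0∞} (hf : Measurable f) (s : Finset κ) :
    ∀ U : ι → G, (∫⋯∫⁻_s, f ∂fun _ : κ => μ) (A U) = 0 →
      (∫⋯∫⁻_s.image β, f ∘ A ∂fun _ : ι => μ) U = 0 := by
  induction s using Finset.induction with
  | empty =>
    intro U hU
    simpa using hU
  | insert c s hc ih =>
    intro U hU
    have hβc : β c ∉ s.image β := fun h => hc (hβ.mem_finset_image.1 h)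
    rw [Finset.image_insert, lmarginal_insert _ (hf.comp hAm) hβc]
    rw [lmarginal_insert _ hf hc] at hU
    -- the inner output marginal vanishes for a.e. value of the output coordinate `c` …
    have hgm : Measurable (∫⋯∫⁻_s, f ∂fun _ : κ => μ) := hf.lmarginal _
    have hae : ∀ᵐ y ∂μ, (∫⋯∫⁻_s, f ∂fun _ : κ => μ) (update (A U) c y) = 0 := by
      have h := (lintegral_eq_zero_iff (hgm.comp (measurable_update _))).1 hU
      filter_upwards [h] with y hy
      simpa using hy
    -- … hence for a.e. value of the private input `β c` (absolute continuity of the one-variable law)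
    have hF : Measurable fun g => A (update U (β c) g) c :=
      (measurable_pi_apply c).comp (hAm.comp (measurable_update _))
    have hae' : ∀ᵐ g ∂μ, (∫⋯∫⁻_s, f ∂fun _ : κ => μ) (update (A U) c (A (update U (β c) g) c)) = 0 :=
      ae_of_ae_map hF.aemeasurable ((hac U c).ae_le hae)
    -- conclude with the induction hypothesis at the updated configurations
    have hGm : Measurable fun g => (∫⋯∫⁻_s.image β, f ∘ A ∂fun _ : ι => μ) (update U (β c) g) :=
      ((hf.comp hAm).lmarginal _).comp (measurable_update _)
    refine (lintegral_eq_zero_iff hGm).2 ?_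
    filter_upwards [hae'] with g hg
    rw [← apply_update_eq hA] at hg
    simpa using ih _ hg

/-- **M3a: TRIANGULAR PUSH-FORWARD THEOREM.** A measurable map between finite products with a private input coordinate per
output coordinate (locality `IsLocal`) whose one-variable laws are all absolutely continuous maps the product measure to an
absolutely continuous measure: `(Measure.pi μ).map A ≪ Measure.pi μ`. [folklore] -/
theorem map_pi_absolutelyContinuous_pi [Fintype ι] [Fintype κ] (hA : IsLocal β A) (hβ : Injective β)
    (hAm : Measurable A) (hac : ∀ (U : ι → G) (c : κ), μ.map (fun g => A (update U (β c) g) c) ≪ μ) :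
    (Measure.pi fun _ : ι => μ).map A ≪ Measure.pi fun _ : κ => μ := by
  rcases isEmpty_or_nonempty (ι → G) with hE | ⟨⟨U₀⟩⟩
  · have h0 : (Measure.pi fun _ : ι => μ) = 0 := Measure.eq_zero_of_isEmpty _
    rw [h0, Measure.map_zero]
    exact Measure.AbsolutelyContinuous.zero _
  refine Measure.AbsolutelyContinuous.mk fun N hN hN0 => ?_
  rw [Measure.map_apply hAm hN]
  set f : (κ → G) → ℝ≥0∞ := N.indicator 1 with hf_def
  have hf : Measurable f := measurable_one.indicator hN
  -- output side: the full marginal of `1_N` is the constant `(pi μ) N = 0`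
  have hκ : ∀ V : κ → G, (∫⋯∫⁻_Finset.univ, f ∂fun _ : κ => μ) V = 0 := fun V => by
    rw [← lintegral_eq_lmarginal_univ (μ := fun _ : κ => μ) V, hf_def, lintegral_indicator_one hN, hN0]
  -- input side: the marginal of `1_N ∘ A` over all private inputs vanishes identically
  have hι : (∫⋯∫⁻_(Finset.univ : Finset κ).image β, f ∘ A ∂fun _ : ι => μ) = 0 :=
    funext fun U => lmarginal_image_eq_zero μ hA hβ hAm hac hf Finset.univ U (hκ (A U))
  -- integrate out the remaining inputs
  have hAN : (Measure.pi fun _ : ι => μ) (A ⁻¹' N) = ∫⁻ U, (f ∘ A) U ∂Measure.pi fun _ : ι => μ := by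
    rw [← lintegral_indicator_one (hAm hN)]
    refine lintegral_congr fun U => ?_
    rw [hf_def, Function.comp_apply, ← Set.indicator_comp_right A, Pi.one_comp]
  have hsplit : (Finset.univ : Finset ι) =
      (Finset.univ \ (Finset.univ : Finset κ).image β) ∪ (Finset.univ : Finset κ).image β :=
    (Finset.sdiff_union_of_subset (Finset.subset_univ _)).symm
  rw [hAN, lintegral_eq_lmarginal_univ (μ := fun _ : ι => μ) U₀, hsplit,
    lmarginal_union (fun _ : ι => μ) (f ∘ A) (hf.comp hAm) Finset.sdiff_disjoint, hι]
  simp [lmarginal]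

end Triangular

/-! ## 4. The resampling proof: one-variable laws a.c. for almost every configuration, `μ` a probability measure -/

section Resampling

variable {E ι κ G : Type*} [MeasurableSpace E] [MeasurableSpace G]

/-- THE MIXTURE ENGINE.  Let `ν` be an s-finite law of an "environment" `e : E`, `μ` a finite measure on `G`, and
`f c : E → G → G` (`c : κ`) jointly measurable one-variable maps such that for `ν`-a.e. `e` and every `c` the law of
`f c e` under `μ` is `≪ μ`.  Then `(e, g) ↦ (c ↦ f c e (g c))` pushes `ν ⊗ μ^κ` to a measure `≪ μ^κ`: conditionally on
`e` the output is a product of independent absolutely continuous coordinates (`Measure.pi_map_pi`,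
`pi_absolutelyContinuous_pi`), and a mixture of absolutely continuous measures is absolutely continuous
(`Measure.prod_apply`). [folklore] -/
theorem map_prod_pi_absolutelyContinuous [Fintype κ] (ν : Measure E) [SFinite ν] (μ : Measure G) [IsFiniteMeasure μ]
    (f : κ → E → G → G) (hf : ∀ c, Measurable (uncurry (f c)))
    (hac : ∀ᵐ e ∂ν, ∀ c, μ.map (f c e) ≪ μ) :
    (ν.prod (Measure.pi fun _ : κ => μ)).map (fun p : E × (κ → G) => fun c => f c p.1 (p.2 c)) ≪
      Measure.pi fun _ : κ => μ := by
  have hΦ : Measurable (fun p : E × (κ → G) => fun c => f c p.1 (p.2 c)) :=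
    measurable_pi_lambda _ fun c =>
      (hf c).comp (measurable_fst.prodMk ((measurable_pi_apply c).comp measurable_snd))
  refine Measure.AbsolutelyContinuous.mk fun s hs hs0 => ?_
  rw [Measure.map_apply hΦ hs, Measure.prod_apply (hΦ hs)]
  refine (lintegral_congr_ae (hac.mono fun e he => ?_)).trans lintegral_zero
  have hfe : ∀ c, Measurable (f c e) := fun c => (hf c).comp (measurable_const.prodMk measurable_id)
  have hΦe : Measurable (fun g : κ → G => fun c => f c e (g c)) :=
    measurable_pi_lambda _ fun c => (hfe c).comp (measurable_pi_apply c)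
  show (Measure.pi fun _ : κ => μ)
      (Prod.mk e ⁻¹' ((fun p : E × (κ → G) => fun c => f c p.1 (p.2 c)) ⁻¹' s)) = 0
  have h1 : Prod.mk e ⁻¹' ((fun p : E × (κ → G) => fun c => f c p.1 (p.2 c)) ⁻¹' s) =
      (fun g : κ → G => fun c => f c e (g c)) ⁻¹' s := rfl
  rw [h1, ← Measure.map_apply hΦe hs, Measure.pi_map_pi (fun c => (hfe c).aemeasurable)]
  exact pi_absolutelyContinuous_pi he hs0

/-- The resampling map `(U, g) ↦ Function.extend β g U` is measurable (coordinatewise it is a projection). [folklore] -/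
theorem measurable_resample [Fintype ι] {β : κ → ι} (hβ : Injective β) :
    Measurable (fun p : (ι → G) × (κ → G) => extend β p.2 p.1) := by
  refine measurable_pi_lambda _ fun i => ?_
  by_cases hi : ∃ c, β c = i
  · obtain ⟨c, rfl⟩ := hi
    have : (fun p : (ι → G) × (κ → G) => extend β p.2 p.1 (β c)) = fun p => p.2 c :=
      funext fun p => hβ.extend_apply _ _ _
    rw [this]
    exact (measurable_pi_apply c).comp measurable_snd
  · have : (fun p : (ι → G) × (κ → G) => extend β p.2 p.1 i) = fun p => p.1 i :=
      funext fun p => extend_apply' _ _ _ hi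
    rw [this]
    exact (measurable_pi_apply i).comp measurable_fst

/-- RESAMPLING PRESERVES THE PRODUCT LAW.  For a probability measure `μ` and an injection `β : κ → ι`, replacing the
coordinates `β c` of `U ∼ μ^ι` by fresh independent `g c ∼ μ` leaves the law `μ^ι` unchanged:
`(U, g) ↦ Function.extend β g U` is measure preserving `μ^ι ⊗ μ^κ → μ^ι` (box computation, `Measure.pi_eq`). [folklore] -/
theorem measurePreserving_resample [Fintype ι] [Fintype κ] (μ : Measure G) [IsProbabilityMeasure μ] {β : κ → ι}
    (hβ : Injective β) :
    MeasurePreserving (fun p : (ι → G) × (κ → G) => extend β p.2 p.1)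
      ((Measure.pi fun _ : ι => μ).prod (Measure.pi fun _ : κ => μ)) (Measure.pi fun _ : ι => μ) := by
  classical
  refine ⟨measurable_resample hβ, (Measure.pi_eq fun s hs => ?_).symm⟩
  rw [Measure.map_apply (measurable_resample hβ) (MeasurableSet.univ_pi hs)]
  have hpre : (fun p : (ι → G) × (κ → G) => extend β p.2 p.1) ⁻¹' (Set.univ.pi s) =
      (Set.univ.pi fun i => if (∃ c, β c = i) then Set.univ else s i) ×ˢ (Set.univ.pi fun c => s (β c)) := by
    ext ⟨U, g⟩
    simp only [Set.mem_preimage, Set.mem_univ_pi, Set.mem_prod]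
    constructor
    · intro h
      refine ⟨fun i => ?_, fun c => ?_⟩
      · by_cases hi : ∃ c, β c = i
        · rw [if_pos hi]
          exact Set.mem_univ _
        · rw [if_neg hi]
          simpa [extend_apply' _ _ _ hi] using h i
      · simpa [hβ.extend_apply] using h (β c)
    · rintro ⟨hU, hg⟩ i
      by_cases hi : ∃ c, β c = i
      · obtain ⟨c, rfl⟩ := hi
        simpa [hβ.extend_apply] using hg c
      · rw [extend_apply' _ _ _ hi]
        simpa [if_neg hi] using hU i
  have h1 : (∏ i, μ (if (∃ c, β c = i) then Set.univ else s i)) =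
      ∏ i ∈ Finset.univ.filter (fun i => ¬ ∃ c, β c = i), μ (s i) := by
    rw [Finset.prod_filter]
    refine Finset.prod_congr rfl fun i _ => ?_
    by_cases hi : ∃ c, β c = i
    · rw [if_pos hi, if_neg (not_not.mpr hi), measure_univ]
    · rw [if_neg hi, if_pos hi]
  have h2 : (∏ c, μ (s (β c))) = ∏ i ∈ Finset.univ.filter (fun i => ∃ c, β c = i), μ (s i) := by
    have himg : Finset.univ.filter (fun i => ∃ c, β c = i) = Finset.univ.image β := by
      ext i
      simp
    rw [himg, Finset.prod_image fun a _ b _ h => hβ h]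
  rw [hpre, Measure.prod_prod, Measure.pi_pi, Measure.pi_pi, h1, h2, mul_comm]
  exact Finset.prod_filter_mul_prod_filter_not _ _ _

/-- **M3a, ALMOST-EVERYWHERE FORM** (row T4-D.G-AC3 as worded: "for a.e. environment, the one-variable section pushes `μ`
to a measure `≪ μ`").  `ι, κ` finite, `β : κ → ι` injective, `μ` a PROBABILITY measure on `G`, `A : (ι → G) → (κ → G)`
measurable and local, and for `μ^ι`-a.e. `U` and every `c`, `μ.map (g ↦ A (update U (β c) g) c) ≪ μ`.  THEN
`(μ^ι).map A ≪ μ^κ`.  Proof: `(μ^ι).map A = (μ^ι ⊗ μ^κ).map (A ∘ res)` (`measurePreserving_resample`), `A ∘ res` is the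
engine's map for `f c U g := A (update U (β c) g) c` (`apply_resample_eq`), and `map_prod_pi_absolutelyContinuous`
applies. [folklore] -/
theorem map_pi_absolutelyContinuous_pi_ae [Fintype ι] [Fintype κ] [DecidableEq ι] (μ : Measure G)
    [IsProbabilityMeasure μ] {β : κ → ι} {A : (ι → G) → (κ → G)} (hA : IsLocal β A) (hβ : Injective β)
    (hAm : Measurable A)
    (hac : ∀ᵐ U ∂(Measure.pi fun _ : ι => μ), ∀ c : κ, μ.map (fun g => A (update U (β c) g) c) ≪ μ) :
    (Measure.pi fun _ : ι => μ).map A ≪ Measure.pi fun _ : κ => μ := by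
  have hf : ∀ c : κ, Measurable (uncurry fun (U : ι → G) (g : G) => A (update U (β c) g) c) := fun c =>
    (measurable_pi_apply c).comp (hAm.comp measurable_update')
  have hres := measurePreserving_resample μ hβ
  have key : (fun p : (ι → G) × (κ → G) => fun c => A (update p.1 (β c) (p.2 c)) c) =
      A ∘ (fun p : (ι → G) × (κ → G) => extend β p.2 p.1) := by
    funext p
    funext c
    exact (apply_resample_eq hA hβ p.1 p.2 c).symm
  have h := map_prod_pi_absolutelyContinuous (Measure.pi fun _ : ι => μ) μ
    (fun c (U : ι → G) (g : G) => A (update U (β c) g) c) hf hac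
  rw [key, ← Measure.map_map hAm hres.measurable, hres.map_eq] at h
  exact h

/-- Sanity link between §3 and §4: for a probability measure the everywhere hypothesis of `map_pi_absolutelyContinuous_pi`
implies the a.e. hypothesis of `map_pi_absolutelyContinuous_pi_ae` (so on probability spaces §4 generalises §3).
[folklore] -/
theorem map_pi_absolutelyContinuous_pi_of_forall [Fintype ι] [Fintype κ] [DecidableEq ι] (μ : Measure G)
    [IsProbabilityMeasure μ] {β : κ → ι} {A : (ι → G) → (κ → G)} (hA : IsLocal β A) (hβ : Injective β)
    (hAm : Measurable A) (hac : ∀ (U : ι → G) (c : κ), μ.map (fun g => A (update U (β c) g) c) ≪ μ) :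
    (Measure.pi fun _ : ι => μ).map A ≪ Measure.pi fun _ : κ => μ :=
  map_pi_absolutelyContinuous_pi_ae μ hA hβ hAm (ae_of_all _ fun U c => hac U c)

end Resampling

end Literature.MathematicalPhysics.QuantumFieldTheory.Balaban1983to89.T4TriangularPushforward

end
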